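import Summits.ValiantsHypothesis.ValiantsHypothesis.Theorems.LacunarySymmetroidMatrixDescartesPivotRankOneCriticalWindowsSandwich

/-!
# `MatrixDescartes` census — rank-one `(2,K)₁`: the TWO-LETTER WINDOW-DIRECTION TEST (exact up to the factor `K − 1`)

HONEST FRAMING.  Object-search cell `pub-symmetroid`, seat `val-sym-mdr-p1` (generation 21); helper file `--supports` the crux item
stmt-ValiantsHypothesis-18050 (`Theses.LacunarySymmetroid.MatrixDescartes`, OPEN, on HOLD) with NO closure claim.  Consequence of the SANDWICH LAW
(`…CriticalWindowsSandwich`) stated WITHOUT any critical-point hypothesis: a direction `T` is a WINDOW DIRECTION of the pencil (some `x > 0` has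
`q_T(x) < 0`, i.e. the window profile `𝔅(x,T) = α/x^m + Σⱼ βⱼx^{nⱼ}` dips below the level `2`; `α = w₀(T−t₀)²/T`, `βⱼ = wⱼ(T−tⱼ)²/T`, `m = e−d₀`,
`nⱼ = dⱼ−e`) according to the EXPLICIT two-letter minima `gⱼ(T) = ((m+nⱼ)/nⱼ)(nⱼ/m)^{m/(m+nⱼ)}·α^{θⱼ}βⱼ^{1−θⱼ}`:
* `not_below_of_pair_ge` — if `gⱼ(T) ≥ c` for SOME `j` then `𝔅(x,T) ≥ c` for EVERY `x > 0` (the lineage's two-letter circuit certificate «N0j», by weighted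
  AM–GM: no window in direction `T` when `c = 2`);
* **`below_of_sum_lt`** — if `Σⱼ gⱼ(T) < c` then `𝔅(x̄,T) < c` at the EXPLICIT point `x̄ =` the smallest of the two-letter minimisers
  `xⱼ = (mα/(nⱼβⱼ))^{1/(m+nⱼ)}` (over the letters with `βⱼ > 0`; any large `x` if there are none): `T` IS a window direction when `c = 2`.
So «window direction» is decided by two-letter data up to the factor `K − 1` between `max gⱼ` and `Σ gⱼ` — the exact form of the tropical needle/tent
dictionary of g16 (NULL-DIRECTION.md §3) in the direction variable.  No count is proved; nothing here bears on `MatrixDescartes` in its window, on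
`DoorA26` / `DoorA34`, registers / credences, or `VP ≠ VNP`.
[folklore] Weighted AM–GM and `Real.rpow` algebra (this file and `…CriticalWindowsSandwich`).  No definitions, no named facts.
-/

-- `Summit.ValiantsHypothesis.ValiantsHypothesis.…` repeats a component by the D-0017 layout
-- (single-conjunct summit), which the `dupNamespace` linter flags; the name is mandated.
set_option linter.dupNamespace false

namespace Summit.ValiantsHypothesis.ValiantsHypothesis.Theorems.LacunarySymmetroidMatrixDescartes.Pivot.CriticalWindows.Sandwich

open Finset
open scoped BigOperators

/-! ## 1. One pair certifies «no window in this direction» -/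

/-- **TWO-LETTER FLOOR AT EVERY POINT.**  For `α ≥ 0`, `βₖ ≥ 0`, `x > 0` and any `j ∈ s`: `gⱼ ≤ α/x^m + Σₖ βₖ x^{nₖ}`. [folklore] -/
theorem pair_le_profile {ι : Type*} (s : Finset ι) (α x : ℝ) (m : ℕ) (β : ι → ℝ) (n : ι → ℕ)
    (hα : 0 ≤ α) (hx : 0 < x) (hm : 0 < m) (hβ : ∀ j ∈ s, 0 ≤ β j) (hn : ∀ j ∈ s, 0 < n j) (j : ι) (hj : j ∈ s) :
    (((m : ℝ) + n j) / n j) * ((n j : ℝ) / m) ^ ((m : ℝ) / (m + n j)) * (α ^ ((n j : ℝ) / (m + n j)) * β j ^ ((m : ℝ) / (m + n j)))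
      ≤ α / x ^ m + ∑ k ∈ s, β k * x ^ (n k) := by
  have hm' : (0 : ℝ) < m := by exact_mod_cast hm
  have hnj : (0 : ℝ) < n j := by exact_mod_cast hn j hj
  have hP₀ : 0 ≤ α / x ^ m := div_nonneg hα (pow_nonneg hx.le m)
  have hpair := sum_ge_critical (α / x ^ m) (β j * x ^ (n j)) m (n j) hP₀ (mul_nonneg (hβ j hj) (pow_nonneg hx.le _)) hm' hnj
  have hθ : (m : ℝ) * ((n j : ℝ) / (m + n j)) = (n j : ℝ) * (1 - (n j : ℝ) / (m + n j)) := by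
    have : (m : ℝ) + n j ≠ 0 := by positivity
    field_simp; ring
  have hone : 1 - (n j : ℝ) / (m + n j) = (m : ℝ) / (m + n j) := by
    have : (m : ℝ) + n j ≠ 0 := by positivity
    field_simp; ring
  have hgeom := geom_factor_eq x α (β j) ((n j : ℝ) / (m + n j)) m (n j) hx hα (hβ j hj) hθ
  rw [hone] at hgeom
  rw [hgeom] at hpair
  have hrest : β j * x ^ (n j) ≤ ∑ k ∈ s, β k * x ^ (n k) :=
    Finset.single_le_sum (fun k hk => mul_nonneg (hβ k hk) (pow_nonneg hx.le _)) hj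
  linarith

/-- **«N0j» CERTIFICATE.**  If some two-letter minimum is `≥ c` then the whole profile is `≥ c` at every `x > 0`; with `c = 2`: no window in the direction `T`.
[folklore] -/
theorem not_below_of_pair_ge {ι : Type*} (s : Finset ι) (α x c : ℝ) (m : ℕ) (β : ι → ℝ) (n : ι → ℕ)
    (hα : 0 ≤ α) (hx : 0 < x) (hm : 0 < m) (hβ : ∀ j ∈ s, 0 ≤ β j) (hn : ∀ j ∈ s, 0 < n j) (j : ι) (hj : j ∈ s)
    (hc : c ≤ (((m : ℝ) + n j) / n j) * ((n j : ℝ) / m) ^ ((m : ℝ) / (m + n j))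
      * (α ^ ((n j : ℝ) / (m + n j)) * β j ^ ((m : ℝ) / (m + n j)))) :
    c ≤ α / x ^ m + ∑ k ∈ s, β k * x ^ (n k) :=
  hc.trans (pair_le_profile s α x m β n hα hx hm hβ hn j hj)

/-! ## 2. The sum of the pairs certifies «window in this direction», at an explicit point -/

/-- `(y^{1/N})^N = y` for `y ≥ 0`, `N ≥ 1`. [folklore] -/
theorem rpow_inv_natCast_pow (y : ℝ) (hy : 0 ≤ y) (N : ℕ) (hN : N ≠ 0) : (y ^ ((1 : ℝ) / N)) ^ N = y := by
  rw [← Real.rpow_natCast, ← Real.rpow_mul hy, one_div_mul_cancel (Nat.cast_ne_zero.2 hN), Real.rpow_one]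

/-- **THE TWO-LETTER MINIMISER.**  For `α, β > 0`, `m, n ≥ 1` the point `x₀ = (mα/(nβ))^{1/(m+n)}` is positive and critical for the pair
(`m·α/x₀^m = n·βx₀^n`), so the pair's value there is the two-letter minimum `g = ((m+n)/n)(n/m)^{m/(m+n)}·α^{n/(m+n)}β^{m/(m+n)}`. [folklore] -/
theorem pair_minimiser (α β : ℝ) (m n : ℕ) (hα : 0 < α) (hβ : 0 < β) (hm : 0 < m) (hn : 0 < n) :
    0 < ((m : ℝ) * α / (n * β)) ^ ((1 : ℝ) / (m + n : ℕ)) ∧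
      (m : ℝ) * (α / (((m : ℝ) * α / (n * β)) ^ ((1 : ℝ) / (m + n : ℕ))) ^ m)
        = (n : ℝ) * (β * (((m : ℝ) * α / (n * β)) ^ ((1 : ℝ) / (m + n : ℕ))) ^ n) ∧
      α / (((m : ℝ) * α / (n * β)) ^ ((1 : ℝ) / (m + n : ℕ))) ^ m + β * (((m : ℝ) * α / (n * β)) ^ ((1 : ℝ) / (m + n : ℕ))) ^ n
        = (((m : ℝ) + n) / n) * ((n : ℝ) / m) ^ ((m : ℝ) / (m + n)) * (α ^ ((n : ℝ) / (m + n)) * β ^ ((m : ℝ) / (m + n))) := by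
  have hm' : (0 : ℝ) < m := by exact_mod_cast hm
  have hn' : (0 : ℝ) < n := by exact_mod_cast hn
  set y : ℝ := (m : ℝ) * α / (n * β) with hy
  have hypos : 0 < y := div_pos (mul_pos hm' hα) (mul_pos hn' hβ)
  set x₀ : ℝ := y ^ ((1 : ℝ) / (m + n : ℕ)) with hx₀
  have hx₀pos : 0 < x₀ := Real.rpow_pos_of_pos hypos _
  have hpow : x₀ ^ (m + n) = y := rpow_inv_natCast_pow y hypos.le (m + n) (by omega)
  -- the critical equation: `m α / x₀^m = n β x₀^n` ⟸ `x₀^{m+n} = m α /(n β)`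
  have hfoc : (m : ℝ) * (α / x₀ ^ m) = (n : ℝ) * (β * x₀ ^ n) := by
    have hxm : x₀ ^ m ≠ 0 := pow_ne_zero _ hx₀pos.ne'
    rw [mul_div_assoc', div_eq_iff hxm]
    have : (n : ℝ) * (β * x₀ ^ n) * x₀ ^ m = (n : ℝ) * β * x₀ ^ (m + n) := by rw [pow_add]; ring
    rw [this, hpow, hy]
    field_simp
  refine ⟨hx₀pos, hfoc, ?_⟩
  -- value at the critical point
  have hA : 0 ≤ α / x₀ ^ m := div_nonneg hα.le (pow_nonneg hx₀pos.le m)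
  rw [critical_sum_eq (α / x₀ ^ m) (β * x₀ ^ n) m n hA hm' hn' hfoc]
  have hθ : (m : ℝ) * ((n : ℝ) / (m + n)) = (n : ℝ) * (1 - (n : ℝ) / (m + n)) := by
    have : (m : ℝ) + n ≠ 0 := by positivity
    field_simp; ring
  have hone : 1 - (n : ℝ) / (m + n) = (m : ℝ) / (m + n) := by
    have : (m : ℝ) + n ≠ 0 := by positivity
    field_simp; ring
  have hgeom := geom_factor_eq x₀ α β ((n : ℝ) / (m + n)) m n hx₀pos hα.le hβ.le hθ
  rw [hone] at hgeom
  rw [hgeom]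

/-- **WINDOW-DIRECTION CERTIFICATE (the converse, up to the factor `K − 1`).**  If `Σⱼ gⱼ < c` (`α > 0`, `βⱼ ≥ 0`, `m, nⱼ ≥ 1`, `c > 0`) then the profile
dips below `c` at an explicit point: `∃ x > 0, α/x^m + Σⱼ βⱼx^{nⱼ} < c`.  Construction: `x̄ =` the smallest two-letter minimiser among the letters with
`βⱼ > 0` — there the `j*`-pair contributes exactly `g_{j*}` and every other term at most its own `gₖ` (its minimiser lies to the right of `x̄`); if no
`βⱼ > 0` the profile is `α/x^m → 0`.  With `c = 2`: `T` is a window direction. [folklore] -/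
theorem below_of_sum_lt {ι : Type*} (s : Finset ι) (α c : ℝ) (m : ℕ) (β : ι → ℝ) (n : ι → ℕ)
    (hα : 0 < α) (hc : 0 < c) (hm : 0 < m) (hβ : ∀ j ∈ s, 0 ≤ β j) (hn : ∀ j ∈ s, 0 < n j)
    (hsum : ∑ j ∈ s, (((m : ℝ) + n j) / n j) * ((n j : ℝ) / m) ^ ((m : ℝ) / (m + n j))
        * (α ^ ((n j : ℝ) / (m + n j)) * β j ^ ((m : ℝ) / (m + n j))) < c) :
    ∃ x : ℝ, 0 < x ∧ α / x ^ m + ∑ k ∈ s, β k * x ^ (n k) < c := by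
  classical
  have hm' : (0 : ℝ) < m := by exact_mod_cast hm
  -- the two-letter minima are non-negative
  have hg_nn : ∀ k ∈ s, 0 ≤ (((m : ℝ) + n k) / n k) * ((n k : ℝ) / m) ^ ((m : ℝ) / (m + n k))
      * (α ^ ((n k : ℝ) / (m + n k)) * β k ^ ((m : ℝ) / (m + n k))) := by
    intro k hk
    have hnk : (0 : ℝ) < n k := by exact_mod_cast hn k hk
    have : 0 ≤ ((n k : ℝ) / m) ^ ((m : ℝ) / (m + n k)) := Real.rpow_nonneg (div_pos hnk hm').le _
    have : 0 ≤ α ^ ((n k : ℝ) / (m + n k)) := Real.rpow_nonneg hα.le _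
    have : 0 ≤ β k ^ ((m : ℝ) / (m + n k)) := Real.rpow_nonneg (hβ k hk) _
    positivity
  set s' := s.filter (fun k => 0 < β k) with hs'
  by_cases hne : s'.Nonempty
  · -- the smallest minimiser among the letters with `βⱼ > 0`
    let xm : ι → ℝ := fun k => ((m : ℝ) * α / (n k * β k)) ^ ((1 : ℝ) / (m + n k : ℕ))
    obtain ⟨j, hj', hjmin⟩ := Finset.exists_min_image s' xm hne
    have hj : j ∈ s := (Finset.mem_filter.1 hj').1
    have hβj : 0 < β j := (Finset.mem_filter.1 hj').2
    obtain ⟨hx₀, -, hval⟩ := pair_minimiser α (β j) m (n j) hα hβj hm (hn j hj)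
    refine ⟨xm j, hx₀, ?_⟩
    -- split the sum at `j`
    rw [← Finset.add_sum_erase s _ hj, ← add_assoc]
    change α / xm j ^ m + β j * xm j ^ n j + ∑ k ∈ s.erase j, β k * xm j ^ n k < c
    rw [hval]
    -- every other term is at most its own two-letter minimum
    have hterm : ∀ k ∈ s.erase j, β k * xm j ^ n k ≤ (((m : ℝ) + n k) / n k) * ((n k : ℝ) / m) ^ ((m : ℝ) / (m + n k))
        * (α ^ ((n k : ℝ) / (m + n k)) * β k ^ ((m : ℝ) / (m + n k))) := by
      intro k hk
      have hks : k ∈ s := Finset.mem_of_mem_erase hk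
      rcases (hβ k hks).eq_or_lt with hβ0 | hβpos
      · rw [← hβ0]; simp only [zero_mul]; exact hβ0 ▸ hg_nn k hks
      · have hk' : k ∈ s' := Finset.mem_filter.2 ⟨hks, hβpos⟩
        obtain ⟨hxk, -, hvalk⟩ := pair_minimiser α (β k) m (n k) hα hβpos hm (hn k hks)
        have hle : xm j ≤ xm k := hjmin k hk'
        calc β k * xm j ^ n k ≤ β k * xm k ^ n k :=
              mul_le_mul_of_nonneg_left (pow_le_pow_left₀ hx₀.le hle _) hβpos.le
          _ ≤ α / xm k ^ m + β k * xm k ^ n k := by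
              have : 0 ≤ α / xm k ^ m := div_nonneg hα.le (pow_nonneg hxk.le m)
              linarith
          _ = _ := hvalk
    have hsum_le := Finset.sum_le_sum hterm
    have hsplit := Finset.add_sum_erase s (fun k => (((m : ℝ) + n k) / n k) * ((n k : ℝ) / m) ^ ((m : ℝ) / (m + n k))
        * (α ^ ((n k : ℝ) / (m + n k)) * β k ^ ((m : ℝ) / (m + n k)))) hj
    linarith
  · -- no letter with `βⱼ > 0`: the profile is `α/x^m`, small for large `x`
    have hβ0 : ∀ k ∈ s, β k = 0 := by
      intro k hk
      by_contra h
      exact hne ⟨k, Finset.mem_filter.2 ⟨hk, lt_of_le_of_ne (hβ k hk) (Ne.symm h)⟩⟩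
    have hzero : ∀ x : ℝ, ∑ k ∈ s, β k * x ^ (n k) = 0 := fun x =>
      Finset.sum_eq_zero fun k hk => by rw [hβ0 k hk, zero_mul]
    -- take `x = α/c + 1 > max(1, α/c)`: then `x^m ≥ x > α/c`
    refine ⟨α / c + 1, by positivity, ?_⟩
    rw [hzero, add_zero]
    have hx1 : 1 ≤ α / c + 1 := by have := div_pos hα hc; linarith
    have hxm : α / c + 1 ≤ (α / c + 1) ^ m := by
      calc α / c + 1 = (α / c + 1) ^ 1 := (pow_one _).symm
        _ ≤ (α / c + 1) ^ m := pow_le_pow_right₀ hx1 hm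
    have hpos : 0 < (α / c + 1) ^ m := by positivity
    rw [div_lt_iff₀ hpos]
    have : α < c * (α / c + 1) := by
      rw [mul_add, mul_div_cancel₀ _ hc.ne']; linarith
    nlinarith

end Summit.ValiantsHypothesis.ValiantsHypothesis.Theorems.LacunarySymmetroidMatrixDescartes.Pivot.CriticalWindows.Sandwich
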